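import Literature.NumberTheory.LFunctions.QuadraticCharacterShiftSumsPrimePow
import HarnessLib

/-!
# Complete shifted sums of a primitive quadratic character (Matomäki–Merikoski, Lemma 2.5)

Topic `Literature/NumberTheory/LFunctions`. Everything in this file is PROVED (theorems and one
definition). Let `χ` be a primitive quadratic Dirichlet character mod `q ≥ 2`, `q = 2^r q'` with
`2 ∤ q'`, `χ₀` the principal character mod `q`, and `h` an EVEN integer. Matomäki–Merikoski,
Lemma 2.5, evaluate the complete sums
`(1/q)∑_{m mod q} χ₀(m)χ₀(±m+h)` (8), `(1/q)∑ χ(m)χ₀(±m+h)` (9), `(1/q)∑ χ(m)χ(±m+h)` (10);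
(10) — "precise evaluation of the character sum (10) is … the reason we can deal with the case
`(h, q)` close to `q`" — produces the secondary main term
`1_{φ(2^r) ∣ h}(−1)^{h/φ(2^r)} ∏_{p ∣ q', p ∤ h} (−1)/(p − 2)` of their Theorem 1.3
(`Literature.Barriers.Parity.MatomakiMerikoski2023_pairCorrelation`). We prove, for `h : ℕ` even
and the sign `s = ±1`:

* `twoAdicSign q h = 1_{φ(2^r) ∣ h} (−1)^{h/φ(2^r)}` (`r = v₂(q)`), written with the same
  `Nat.totient (2 ^ padicValNat 2 q)` expressions as the target fact;
* (10) `shiftSum_quad_quad_eq_of_sign`: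
  `∑_{m mod q} χ(m)χ(sm + h) = q · twoAdicSign q h · χ(s) · ∏_{p ∣ q} c_p`,
  `c_p = 1 − 1/p` if `p ∣ h`, `c_p = −1/p` if `p ∤ h` — i.e. (10) as printed, times `q`
  (`MatomakiMerikoski2023_lemma25_quad_quad` is the printed `(1/q)·` form with the two products
  `∏_{p ∣ (q,h)} (1 − 1/p) ∏_{p ∣ q, p ∤ h} (−1/p)`);
* (8) `shiftSum_one_one_eq_of_sign`: `∑ χ₀(m)χ₀(sm + h) = q ∏_{p ∣ q} c'_p`, `c'_p = 1 − 1/p`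
  (`p ∣ h`), `1 − 2/p` (`p ∤ h`), for every modulus `q` carrying a primitive quadratic character;
* (9) `shiftSum_quad_one_eq_of_sign`: `∑ χ(m)χ₀(sm + h) = (−1)^{ω(q)} χ(−sh)`.
  ERRATUM: the source prints `−χ(∓h)/q` for `(1/q)·`(9); the local factor at each odd prime is
  `−χ_p(∓h)`, so the sign is `(−1)^{ω(q)}` (for `q = 15`, `h = 2`, `s = 1` the sum is `−1` while
  `−χ(−2) = +1`); for even `q` both sides vanish. The source uses (9) only through
  `|(9)| ≤ 1_{(h,q)=1}/q` (§7, the terms `Σ_{S,L}`, `Σ_{L,S}`), which the corrected form also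
  gives (`norm_shiftSum_quad_one_le`), so Theorem 1.3 is unaffected.

Method (the source's §3.4): "we have that `r ∈ {0, 2, 3}` and `q'` is square-free … by the
Chinese remainder theorem it suffices to consider the prime case `q = p > 2` and the case
`q = 2^r` with `r ∈ {2, 3}`" — here an induction over `q = p^n · a`, `p ∤ a`
(`Nat.recOnPrimePow`) using the multiplicativity `shiftSum_eq_mul_of_coprime` and the
primitivity of CRT components (`DirichletCharacterCRT.lean`), the prime-power structure and the
local values (`QuadraticCharacterShiftSumsLocal.lean`, `…Two.lean`).

## References

* K. Matomäki, J. Merikoski, *Siegel zeros, twin primes, Goldbach's conjecture, and primes in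
  short intervals*, IMRN 2023:23, 20337–20384 (arXiv:2112.11412), Lemma 2.5 ((8)–(10)) and
  §3.4. [cite: MatomakiMerikoski2023, Lemma 2.5]
* H. L. Montgomery, R. C. Vaughan, *Multiplicative Number Theory I*, CUP 2007, Lemma 9.3, §9.3.
  [cite: MontgomeryVaughan2007, §9.3]
-/

noncomputable section

open DirichletCharacter Finset

namespace Literature.NumberTheory.LFunctions

/-! ### The level `1` -/

/-- Every shifted sum mod `1` equals `1`. [folklore] -/
theorem shiftSum_level_one (ψ₁ ψ₂ : DirichletCharacter ℂ 1) (s t : ZMod 1) :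
    shiftSum ψ₁ ψ₂ s t = 1 := by
  haveI : Subsingleton (ZMod 1) := ZMod.subsingleton_iff.mpr rfl
  rw [shiftSum_def, Fintype.sum_subsingleton _ (1 : ZMod 1), Subsingleton.elim (s * 1 + t) 1,
    map_one, map_one, mul_one]

/-! ### The global evaluations (induction over the factorisation of `q`) -/

/-- The prime factors of `p^n a`, `p ∤ a`: `{p} ∪ primeFactors a`, disjointly; product form.
[folklore] -/
theorem prod_primeFactors_prime_pow_mul {p n a : ℕ} (hp : p.Prime) (hpa : ¬ p ∣ a) (hn : 0 < n)
    (ha : a ≠ 0) (f : ℕ → ℂ) :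
    ∏ l ∈ (p ^ n * a).primeFactors, f l = f p * ∏ l ∈ a.primeFactors, f l := by
  rw [Nat.primeFactors_mul (pow_ne_zero n hp.ne_zero) ha, Nat.primeFactors_prime_pow hn.ne' hp,
    Finset.prod_union (Finset.disjoint_singleton_left.mpr fun hmem =>
      hpa (Nat.dvd_of_mem_primeFactors hmem)), Finset.prod_singleton]

/-- (10), `s = 1`, in `∀`-form for the induction. [cite: MatomakiMerikoski2023, Lemma 2.5] -/
theorem shiftSum_quad_quad_aux {h : ℕ} (hh : Even h) :
    ∀ (q : ℕ) (_ : NeZero q) (χ : DirichletCharacter ℂ q), χ.IsPrimitive → χ.IsQuadratic →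
      shiftSum χ χ 1 (h : ZMod q) =
        (q : ℂ) * (twoAdicSign q h : ℂ) *
          ∏ l ∈ q.primeFactors, (if l ∣ h then 1 - 1 / (l : ℂ) else -1 / (l : ℂ)) := by
  intro q
  induction q using Nat.recOnPrimePow with
  | zero => intro hq; exact (not_neZero.mpr rfl hq).elim
  | one =>
    intro _ χ _ _
    rw [shiftSum_level_one, Nat.primeFactors_one, Finset.prod_empty,
      twoAdicSign_of_not_two_dvd (by norm_num) hh]
    norm_num
  | prime_pow_mul a p n hp hpa hn ih =>
    intro hq χ hprim hquad
    have ha : a ≠ 0 := fun ha => by rw [ha, mul_zero] at hq; exact not_neZero.mpr rfl hq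
    haveI : NeZero a := ⟨ha⟩
    haveI : NeZero (p ^ n) := ⟨pow_ne_zero n hp.ne_zero⟩
    have hcop : (p ^ n).Coprime a := Nat.Coprime.pow_left n (hp.coprime_iff_not_dvd.mpr hpa)
    have hmul := shiftSum_eq_mul_of_coprime hcop χ χ 1 ((h : ℕ) : ZMod (p ^ n * a))
    rw [ZMod.cast_one (dvd_mul_right _ _), ZMod.cast_one (dvd_mul_left _ _),
      ZMod.cast_natCast (dvd_mul_right _ _), ZMod.cast_natCast (dvd_mul_left _ _)] at hmul
    rw [hmul, shiftSum_quad_quad_primePow hp hn (crtFst hcop χ) (isPrimitive_crtFst hcop hprim)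
        (IsQuadratic.crtFst hcop hquad) hh,
      ih inferInstance (crtSnd hcop χ) (isPrimitive_crtSnd hcop hprim)
        (IsQuadratic.crtSnd hcop hquad),
      prod_primeFactors_prime_pow_mul hp hpa hn ha, twoAdicSign_mul (pow_ne_zero n hp.ne_zero) ha
        hcop hh, Nat.cast_mul, Int.cast_mul]
    ring

/-- (9), `s = 1`, in `∀`-form for the induction (corrected sign).
[cite: MatomakiMerikoski2023, Lemma 2.5] -/
theorem shiftSum_quad_one_aux {h : ℕ} (hh : Even h) :
    ∀ (q : ℕ) (_ : NeZero q) (χ : DirichletCharacter ℂ q), χ.IsPrimitive → χ.IsQuadratic →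
      shiftSum χ 1 1 (h : ZMod q) = (-1) ^ q.primeFactors.card * χ (-(h : ZMod q)) := by
  intro q
  induction q using Nat.recOnPrimePow with
  | zero => intro hq; exact (not_neZero.mpr rfl hq).elim
  | one =>
    intro _ χ _ _
    haveI : Subsingleton (ZMod 1) := ZMod.subsingleton_iff.mpr rfl
    rw [shiftSum_level_one, Nat.primeFactors_one, Finset.card_empty, pow_zero, one_mul,
      Subsingleton.elim (-(h : ZMod 1)) 1, map_one]
  | prime_pow_mul a p n hp hpa hn ih =>
    intro hq χ hprim hquad
    have ha : a ≠ 0 := fun ha => by rw [ha, mul_zero] at hq; exact not_neZero.mpr rfl hq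
    haveI : NeZero a := ⟨ha⟩
    haveI : NeZero (p ^ n) := ⟨pow_ne_zero n hp.ne_zero⟩
    have hcop : (p ^ n).Coprime a := Nat.Coprime.pow_left n (hp.coprime_iff_not_dvd.mpr hpa)
    have hmul := shiftSum_eq_mul_of_coprime hcop χ 1 1 ((h : ℕ) : ZMod (p ^ n * a))
    rw [ZMod.cast_one (dvd_mul_right _ _), ZMod.cast_one (dvd_mul_left _ _),
      ZMod.cast_natCast (dvd_mul_right _ _), ZMod.cast_natCast (dvd_mul_left _ _),
      crtFst_one, crtSnd_one] at hmul
    have hsplit : χ (-(h : ZMod (p ^ n * a))) =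
        crtFst hcop χ (-(h : ZMod (p ^ n))) * crtSnd hcop χ (-(h : ZMod a)) := by
      have := apply_intCast_eq_mul hcop χ (-(h : ℤ))
      push_cast at this
      exact this
    rw [hmul, shiftSum_quad_one_primePow hp hn (crtFst hcop χ) (isPrimitive_crtFst hcop hprim)
        (IsQuadratic.crtFst hcop hquad) hh,
      ih inferInstance (crtSnd hcop χ) (isPrimitive_crtSnd hcop hprim)
        (IsQuadratic.crtSnd hcop hquad),
      hsplit, Nat.primeFactors_mul (pow_ne_zero n hp.ne_zero) ha,
      Nat.primeFactors_prime_pow hn.ne' hp,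
      Finset.card_union_of_disjoint (Finset.disjoint_singleton_left.mpr fun hmem =>
        hpa (Nat.dvd_of_mem_primeFactors hmem)), Finset.card_singleton, pow_add, pow_one]
    ring

/-- (8), `s = 1`, in `∀`-form for the induction. [cite: MatomakiMerikoski2023, Lemma 2.5] -/
theorem shiftSum_one_one_aux {h : ℕ} (hh : Even h) :
    ∀ (q : ℕ) (_ : NeZero q) (χ : DirichletCharacter ℂ q), χ.IsPrimitive → χ.IsQuadratic →
      shiftSum (1 : DirichletCharacter ℂ q) 1 1 (h : ZMod q) =
        (q : ℂ) * ∏ l ∈ q.primeFactors, (if l ∣ h then 1 - 1 / (l : ℂ) else 1 - 2 / (l : ℂ)) := by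
  intro q
  induction q using Nat.recOnPrimePow with
  | zero => intro hq; exact (not_neZero.mpr rfl hq).elim
  | one =>
    intro _ χ _ _
    rw [shiftSum_level_one, Nat.primeFactors_one, Finset.prod_empty]
    norm_num
  | prime_pow_mul a p n hp hpa hn ih =>
    intro hq χ hprim hquad
    have ha : a ≠ 0 := fun ha => by rw [ha, mul_zero] at hq; exact not_neZero.mpr rfl hq
    haveI : NeZero a := ⟨ha⟩
    haveI : NeZero (p ^ n) := ⟨pow_ne_zero n hp.ne_zero⟩
    have hcop : (p ^ n).Coprime a := Nat.Coprime.pow_left n (hp.coprime_iff_not_dvd.mpr hpa)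
    have hmul := shiftSum_eq_mul_of_coprime hcop (1 : DirichletCharacter ℂ (p ^ n * a)) 1 1
      ((h : ℕ) : ZMod (p ^ n * a))
    rw [ZMod.cast_one (dvd_mul_right _ _), ZMod.cast_one (dvd_mul_left _ _),
      ZMod.cast_natCast (dvd_mul_right _ _), ZMod.cast_natCast (dvd_mul_left _ _),
      crtFst_one, crtSnd_one] at hmul
    rw [hmul, shiftSum_one_one_primePow hp hn (crtFst hcop χ) (isPrimitive_crtFst hcop hprim)
        (IsQuadratic.crtFst hcop hquad) hh,
      ih inferInstance (crtSnd hcop χ) (isPrimitive_crtSnd hcop hprim)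
        (IsQuadratic.crtSnd hcop hquad),
      prod_primeFactors_prime_pow_mul hp hpa hn ha, Nat.cast_mul]
    ring

/-! ### Lemma 2.5 as stated (both signs) -/

section main

variable {q : ℕ} [NeZero q] (χ : DirichletCharacter ℂ q)

/-- The sign `s = ±1` factors out as `χ(s)` (for `s = −1` this is `shiftSum_neg`). [folklore] -/
theorem shiftSum_sign (ψ : DirichletCharacter ℂ q) {s : ℤ} (hs : s = 1 ∨ s = -1) (t : ZMod q) :
    shiftSum χ ψ (s : ZMod q) t = χ (s : ZMod q) * shiftSum χ ψ 1 t := by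
  rcases hs with rfl | rfl
  · rw [Int.cast_one, map_one, one_mul]
  · rw [Int.cast_neg, Int.cast_one, shiftSum_neg]

/-- **Matomäki–Merikoski, Lemma 2.5 (10)** (times `q`): for a primitive quadratic character `χ`
mod `q`, `s = ±1` and even `h`,
`∑_{m mod q} χ(m)χ(sm + h) = q · 1_{φ(2^r) ∣ h}(−1)^{h/φ(2^r)} · χ(s) · ∏_{p ∣ q} c_p` with
`c_p = 1 − 1/p` for `p ∣ h` and `c_p = −1/p` for `p ∤ h` (`r = v₂(q)`).
[cite: MatomakiMerikoski2023, Lemma 2.5] -/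
theorem shiftSum_quad_quad_eq_of_sign (hprim : χ.IsPrimitive) (hquad : χ.IsQuadratic) {s : ℤ}
    (hs : s = 1 ∨ s = -1) {h : ℕ} (hh : Even h) :
    shiftSum χ χ (s : ZMod q) (h : ZMod q) =
      (q : ℂ) * (twoAdicSign q h : ℂ) * χ (s : ZMod q) *
        ∏ p ∈ q.primeFactors, (if p ∣ h then 1 - 1 / (p : ℂ) else -1 / (p : ℂ)) := by
  rw [shiftSum_sign χ χ hs, shiftSum_quad_quad_aux hh q inferInstance χ hprim hquad]
  ring

/-- **Matomäki–Merikoski, Lemma 2.5 (10), as printed**: "Let `q ≥ 2` and let `χ` be a primitive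
quadratic character of modulus `q = 2^r q'` with `r ≥ 0` and `2 ∤ q'` … let `h` be an even
integer. Then `(1/q)∑_{m (mod q)} χ(m)χ(±m + h) =
1_{φ(2^r) ∣ h}(−1)^{h/φ(2^r)} χ(±1) ∏_{p ∣ (q,h)} (1 − 1/p) ∏_{p ∣ q, p ∤ h} (−1)/p`" (here
`h ≥ 0`; `±` is `s = ±1`). [cite: MatomakiMerikoski2023, Lemma 2.5 (10)] -/
theorem MatomakiMerikoski2023_lemma25_quad_quad (hprim : χ.IsPrimitive) (hquad : χ.IsQuadratic)
    {s : ℤ} (hs : s = 1 ∨ s = -1) {h : ℕ} (hh : Even h) :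
    (1 / (q : ℂ)) * ∑ m : ZMod q, χ m * χ (s * m + h) =
      (twoAdicSign q h : ℂ) * χ (s : ZMod q) *
        ((∏ p ∈ q.primeFactors.filter (· ∣ h), (1 - 1 / (p : ℂ))) *
          ∏ p ∈ q.primeFactors.filter (fun p => ¬ p ∣ h), (-1 / (p : ℂ))) := by
  have hq0 : (q : ℂ) ≠ 0 := Nat.cast_ne_zero.mpr (NeZero.ne q)
  rw [← Finset.prod_ite, ← shiftSum_def, shiftSum_quad_quad_eq_of_sign χ hprim hquad hs hh]
  field_simp

/-- **Matomäki–Merikoski, Lemma 2.5 (8)** (times `q`): for `s = ±1`, even `h`, and a modulus `q`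
carrying a primitive quadratic character,
`∑_{m mod q} χ₀(m)χ₀(sm + h) = q ∏_{p ∣ (q,h)} (1 − 1/p) ∏_{p ∣ q, p ∤ h} (1 − 2/p)`.
[cite: MatomakiMerikoski2023, Lemma 2.5 (8)] -/
theorem shiftSum_one_one_eq_of_sign (hprim : χ.IsPrimitive) (hquad : χ.IsQuadratic) {s : ℤ}
    (hs : s = 1 ∨ s = -1) {h : ℕ} (hh : Even h) :
    shiftSum (1 : DirichletCharacter ℂ q) 1 (s : ZMod q) (h : ZMod q) =
      (q : ℂ) * ∏ p ∈ q.primeFactors, (if p ∣ h then 1 - 1 / (p : ℂ) else 1 - 2 / (p : ℂ)) := by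
  have h1 : (1 : DirichletCharacter ℂ q) (s : ZMod q) = 1 := by
    refine MulChar.one_apply ?_
    rcases hs with rfl | rfl
    · rw [Int.cast_one]; exact isUnit_one
    · rw [Int.cast_neg, Int.cast_one]; exact isUnit_one.neg
  rw [shiftSum_sign 1 1 hs, h1, one_mul, shiftSum_one_one_aux hh q inferInstance χ hprim hquad]

/-- **Matomäki–Merikoski, Lemma 2.5 (8), as printed**: "`(1/q)∑_{m (mod q)} χ₀(m)χ₀(±m + h) =
∏_{p ∣ (q,h)} (1 − 1/p) ∏_{p ∣ q, p ∤ h} (1 − 2/p)`" (`χ₀` the principal character mod `q`, the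
level of a primitive quadratic character; `h ≥ 0` even).
[cite: MatomakiMerikoski2023, Lemma 2.5 (8)] -/
theorem MatomakiMerikoski2023_lemma25_one_one (hprim : χ.IsPrimitive) (hquad : χ.IsQuadratic)
    {s : ℤ} (hs : s = 1 ∨ s = -1) {h : ℕ} (hh : Even h) :
    (1 / (q : ℂ)) * ∑ m : ZMod q, (1 : DirichletCharacter ℂ q) m *
        (1 : DirichletCharacter ℂ q) (s * m + h) =
      (∏ p ∈ q.primeFactors.filter (· ∣ h), (1 - 1 / (p : ℂ))) *
        ∏ p ∈ q.primeFactors.filter (fun p => ¬ p ∣ h), (1 - 2 / (p : ℂ)) := by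
  have hq0 : (q : ℂ) ≠ 0 := Nat.cast_ne_zero.mpr (NeZero.ne q)
  rw [← Finset.prod_ite, ← shiftSum_def, shiftSum_one_one_eq_of_sign χ hprim hquad hs hh]
  field_simp

/-- **Matomäki–Merikoski, Lemma 2.5 (9), corrected sign** (times `q`): for a primitive quadratic
`χ` mod `q`, `s = ±1`, even `h`: `∑_{m mod q} χ(m)χ₀(sm + h) = (−1)^{ω(q)} χ(−s h)`. The source
prints `−χ(∓h)` (i.e. `−χ(−sh)`); see the module docstring for the discrepancy, which does not
affect its use (`|·| ≤ 1`, vanishing unless `(h, q) = 1`).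
[cite: MatomakiMerikoski2023, Lemma 2.5 (9)] -/
theorem shiftSum_quad_one_eq_of_sign (hprim : χ.IsPrimitive) (hquad : χ.IsQuadratic) {s : ℤ}
    (hs : s = 1 ∨ s = -1) {h : ℕ} (hh : Even h) :
    shiftSum χ 1 (s : ZMod q) (h : ZMod q) =
      (-1) ^ q.primeFactors.card * χ (-(s : ZMod q) * h) := by
  rw [shiftSum_sign χ 1 hs, shiftSum_quad_one_aux hh q inferInstance χ hprim hquad,
    show -(s : ZMod q) * h = (s : ZMod q) * (-(h : ZMod q)) by ring, map_mul]
  ring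

/-- The corrected (9) in the printed normalisation:
`(1/q)∑_{m (mod q)} χ(m)χ₀(±m + h) = (−1)^{ω(q)} χ(∓h)/q` (source: `−χ(∓h)/q`).
[cite: MatomakiMerikoski2023, Lemma 2.5 (9)] -/
theorem MatomakiMerikoski2023_lemma25_quad_one (hprim : χ.IsPrimitive) (hquad : χ.IsQuadratic)
    {s : ℤ} (hs : s = 1 ∨ s = -1) {h : ℕ} (hh : Even h) :
    (1 / (q : ℂ)) * ∑ m : ZMod q, χ m * (1 : DirichletCharacter ℂ q) (s * m + h) =
      (-1) ^ q.primeFactors.card * χ (-(s : ZMod q) * h) / q := by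
  rw [← shiftSum_def, shiftSum_quad_one_eq_of_sign χ hprim hquad hs hh]
  ring

/-- What the source uses of (9) in §7: `|∑_{m mod q} χ(m)χ₀(±m + h)| ≤ 1`, and the sum vanishes
unless `(h, q) = 1`. [cite: MatomakiMerikoski2023, §7] -/
theorem norm_shiftSum_quad_one_le (hprim : χ.IsPrimitive) (hquad : χ.IsQuadratic) {s : ℤ}
    (hs : s = 1 ∨ s = -1) {h : ℕ} (hh : Even h) :
    ‖shiftSum χ 1 (s : ZMod q) (h : ZMod q)‖ ≤ 1 ∧
      (¬ h.Coprime q → shiftSum χ 1 (s : ZMod q) (h : ZMod q) = 0) := by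
  rw [shiftSum_quad_one_eq_of_sign χ hprim hquad hs hh]
  constructor
  · rw [norm_mul, norm_pow, norm_neg, norm_one, one_pow, one_mul]
    rcases hquad (-(s : ZMod q) * h) with h0 | h1 | hm1
    · rw [h0, norm_zero]; exact zero_le_one
    · rw [h1, norm_one]
    · rw [hm1, norm_neg, norm_one]
  · intro hncop
    have hnu : ¬ IsUnit (-(s : ZMod q) * (h : ZMod q)) := by
      intro hu
      apply hncop
      have hh' : IsUnit ((h : ℕ) : ZMod q) := isUnit_of_mul_isUnit_right hu
      exact (ZMod.isUnit_iff_coprime h q).mp hh'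
    rw [χ.map_nonunit hnu, mul_zero]

end main

end Literature.NumberTheory.LFunctions
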